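import Summits.QuantumFields.YangMills.Theorems.BalabanUVNodesN05SubBP2DSlotExistsOfThm33JunctionHWithQQP
import Literature.MathematicalPhysics.QuantumFieldTheory.Balaban1983to89.B8Prop6Reg335ZdDomainSeq

/-!
# BalabanUVNodes ∕ N05 ([Balaban1985RegularSpaces] Lemma 1 p. 79 – Thm 8 p. 101): THE J-N06→N05 JUNCTION APPLIED ON THE «P₂D» ROAD AT THE `ℤᵈ` FRAME OF RECORD,
# WITH THE PROPOSITION-6 BINDER DISCHARGED — `BalabanUVNodesN05SubBP2DSlotExistsOfThm33JunctionHWithQQP` at the PARTIAL frame pin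
# `I := MemberZd θ.D θ.L`, `mem := memZd`, `bg := bgZd θ.𝔸 θ.L`, `ιCfg := ιCfgZd θ.𝔸 θ.L` (dag-n06-e's `B9SupplySockB9P3ZdFrame`; `geo ∕ Gp ∕ GA ∕ ιLoc ∕ ops` FREE),
# its junction binder `hP6 : ∀ M j m, … → Prop6At …` («U₀ ∈ 𝔄({Ω_j}, α₀) ⟹ U₀ satisfies (3.35) of [4]», [B8] p. 99) PROVED by [B8] Proposition 6
# (dag-n05-e's `B8Prop6Reg335ZdDomainSeq.prop6At_binder_domainSeq_holds`), so EIGHT junction binders remain displayed instead of nine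

Track A of `YM-PLAN.md` (cell `pub-ymgap`, HUMAN RULING D-0062), node **N05** = [Balaban1985RegularSpaces] («B8»), in-edge **N06** = [Balaban1985BackgroundPropagators]
(«B9», print's ref. [4]); seat `pub-ymgap-dag-n05-e` (g17), 2026-08-28, on dag-n05-d g13's word «n05-e FILE IT» (cell bus); bears on K1⁹ `stmt-QuantumFields-27364`
(`--supports … --as helper`, count-neutral).

WHY.  Print, p. 99: «The configuration U₁ in a neighborhood of □ is obtained from U₀ by a gauge transformation, hence for α₀ sufficiently small we have proved the
regularity condition (3.35).  This implies that we can drop out this condition from the assumption (1.33).»  In the tree the J-N06→N05 junction of dag-n06-b displays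
that sentence as the binder `Prop6At bg L mem ιCfg c35 c₆ K₆ M i m` («for `U₀ ∈ 𝔄_m({Ω_j}, α₀)` unitary, `0 < α₀`, `M·α₀ ≤ c₆`: `(bg (mem M i m)).Reg335 c35 (K₆α₀) (ιCfg … U₀)`»),
and the companion `…JunctionHWithQQP` (dag-n05-d g13) carries it as the hypothesis `hP6` at an ABSTRACT frame.  The binder reads only `(I, bg, mem, ιCfg)` of the frame
tuple; at dag-n06-e's `ℤᵈ` frame of record (`bgZd`: the GENUINE class (3.35) on the p. 396 cube class of the member) it is a THEOREM for every (1.3)–(1.4) member: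
`B8Prop6Reg335ZdDomainSeq.prop6At_binder_domainSeq_holds` (`d ≥ 2`, odd `L ≥ 5`; thresholds `c35⁽⁶⁾, c₆, K₆ > 0`, `M₆ = 11d + 1`), and every `j : Node00.IdxB8SubD θ` IS
such a member (`IdxB8SubD.domainSeq`; moreover `Ω₀ = ℤᵈ`, `IdxB8SubD.Ω_zero` — the members at which dag-n06-b's LOCATED-SELF-7 (cell bus 2026-08-28) certifies the
frame-keyed Theorem-3.3 road SOUND for the genuine record).  So the N05 row needs EIGHT junction binders + [4]'s letters + N06's `B9.Thm33Printed c35 geo (bgZd θ.𝔸 θ.L) Gp GA`.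

THE `c35` ∕ `M₃` PLUMBING (print: «O(1)» of (3.35) is Proposition 6's `7dL²B₁R₁M₁`, p. 99 (1.134); [4]'s theorems hold for every «O(1)» with constants depending on it).
Proposition 6 PRODUCES a threshold pair `(c35₀, M₆)`; the theorem is stated for every leaf constant `c35 ≥ c35₀` and every junction floor `M₃ ≥ M₆` — `Thm33Printed`
and the eight binders are read at that ONE `c35` (by name, unchanged), the Proposition-6 class constant being moved up to it by dag-n05-e's `prop6At_bgZd_mono`
(the class (3.35) grows with its constant, so `Prop6At` at a larger `c35` is the WEAKER statement — sound direction); reading N06 at a larger `c35` asks MORE of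
N06 (Theorem 3.3 over a larger background class) — print's own order: (3.35)'s «O(1)» is fixed by Proposition 6 first, then [4]'s theorems are invoked for that class;
`c₆, K₆` are Proposition 6's own numbers and no longer appear among the hypotheses.  DIFF vs the companion, exhaustively: (i) `(I, mem, bg, ιCfg)` pinned as above;
(ii) `hP6`, `c₆`, `K₆`, `hc₆`, `hK₆` gone; (iii) `c35₀ ≤ c35` and `M₆ ≤ M₃` added under `∃ c35₀ M₆ > 0`; every other hypothesis VERBATIM (same texts, same guards, same order).

WHAT IS PROVED (one theorem; no estimate; no new definition):
* ★★★ **`exists_residB8_b8LeafOfRecordSubBP₂D_cutSubBP₅_of_letters_thm33_junctionH_withQQP_P6`** — for `θ : Node00.Stage3Params` with `2 ≤ θ.D`, `5 ≤ θ.L`: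
  `∃ c35₀ M₆ > 0, ∀ c35 ≥ c35₀, ∀ M₃ ≥ M₆,` [4]'s letters `SLet ∕ SLetUB` (dag-n05-d p619291's texts verbatim), ANY half-frame `(geo, Gp, GA, ιLoc, ops)` over
  `MemberZd θ.D θ.L` with backgrounds `bgZd θ.𝔸 θ.L`, N06's **`B9.Thm33Printed c35 geo (bgZd θ.𝔸 θ.L) Gp GA` BY NAME**, the genuine averaging letter pin `hops` (as in the
  companion), and the EIGHT junction binders `DictAt ∕ InvAtH ∕ CurvAtInAk ∕ LandauAt ∕ HolderAtδ2 ∕ LinBddAt ∕ SrcAt ∕ SrcHolderAtδ2` at every `j : IdxB8SubD θ`, guarded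
  `1 ≤ M → M₃ ≤ M → m ≤ j.k →` ⊢ `∃ lam c₁ ρ₀, B8LeafOfRecordSubBP₂D θ (lam.cutSubBP₅ c₁ ρ₀)`.  Proof: `prop6At_binder_domainSeq_holds` (at `P := ⊤`), `prop6At_bgZd_mono`,
  ONE application of the companion.
HONEST FRAMING: by-name composition (dag-n05-d's companion ∘ dag-n05-e's p620522); 0 estimates; [B8] Proposition 6 is CONSUMED (a tree theorem, unconditional for `d ≥ 2`,
odd `L ≥ 5`), nothing of [4] is proved; the displayed [4] letters, `Thm33Printed` and the eight junction binders are HYPOTHESES (N06's object layer on `ℤᵈ`, `m ≥ 1` OPEN;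
class-wide satisfiability NOT claimed; no positive A6 witness claimed); CLASS NOTE of the companion (dag-n05-w2's LOCATED-PRINT-CLASS: binders over ALL `IdxB8SubD`
members, wider than print's (1.4) regime; exit = one `Subtype` cut later) applies verbatim; Proposition 7 in the repaired currency (WATCH-P7-CURRENCY-RECORD);
count-neutral; **N05 NOT discharged**; K1⁹ NOT claimed; Bałaban AS PRINTED; one finite 𝕋⁴ programme at fixed ε; nothing continuum ∕ ℝ⁴ ∕ OS ∕ mass-gap ∕ Clay.
No `sorry`, no new definition.  Unit `pub-ymgap-dag-n05-e` (g17).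

v1.1 (APPEND-ONLY, same seat): §2 ★★★ **`…_withQQP_P6I` — THE INDEX-GENERIC EDITION.**  §1 pins the WHOLE frame index `I := MemberZd θ.D θ.L`; but N06's
Theorem-3.3 sentence at the `ℤᵈ` frame is SOUND only over sub-indices of `Ω₀ = ℤᵈ` members (dag-n06-b's LOCATED-SELF-7 and its COROLLARY, cell bus 2026-08-28:
over any index containing a `cubeFam false` member the frame-keyed sentence for the genuine `G_𝔤` is false; dag-n06-e's `B9SupplySockB9P3ZdInstance.thm33Printed_comap`
∕ HONEST SCOPE (b): the sentence restricts along any re-indexing map `f : J → I`, `bg ↦ fun j => bg (f j)`).  §2 therefore keeps the index `I`, the member map `mem`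
and the half-frame `(geo, Gp, GA, ιLoc, ops)` FREE and pins only the BACKGROUNDS THROUGH A RE-INDEXING MAP `π : I → MemberZd θ.D θ.L` — `bg := fun i => bgZd θ.𝔸 θ.L (π i)`,
`ιCfg := ιCfgZd` (the configuration carrier `CfgZd` of `bgZd` does not depend on the member) — under the one compatibility `hmem : π (mem M j m) = memZd M j m` at the
(1.3)–(1.5)-admissible members `j : IdxB8SubD θ` (the only members at which the binders are read).  A consumer holding N06's sentence over a sound sub-index
`J ⊆ {Ω₀ = ℤᵈ}` takes `I := J`, `π := Subtype.val`, `mem M i m := ⟨memZd M i m, _⟩` on the admissible data (any value elsewhere) and `hmem := rfl` there; §1 is the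
instance `π := id`, `mem := memZd`.  The `hP6` discharge transports p620522's binder along `hmem` through dag-n06-e's `reg335_bgZd_iff` (the (3.35) field unfolded).
[cite: Balaban1985RegularSpaces, Lemma 1 – Thm 8 pp.79–101, Prop. 6 (1.134)–(1.138) p.99, (1.33) p.82, (1.3)–(1.5) p.77; Balaban1985BackgroundPropagators, (3.35) p.396, (3.16) p.393, Thm 3.1 p.397, Thm 3.3 p.399, p.399 («the constants … depend on d, L only»)]
-/

noncomputable section

namespace Summit.QuantumFields.YangMills.BalabanUVNodes.N05SubBP2DSlotExistsOfThm33JunctionHWithQQPP6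

open Literature.MathematicalPhysics.QuantumFieldTheory.Balaban1983to89
open Literature.MathematicalPhysics.QuantumFieldTheory.Balaban1983to89.Node00
open Literature.MathematicalPhysics.QuantumFieldTheory.Balaban1983to89.B8IdxB8LawsB (IdxB8LawsB)
open Literature.MathematicalPhysics.QuantumFieldTheory.Balaban1983to89.B8LeafModelZd (ZdIdx)
open Literature.MathematicalPhysics.QuantumFieldTheory.Balaban1983to89.B8TowerBondsPrinted (towerBondsP)
open Literature.MathematicalPhysics.QuantumFieldTheory.Balaban1983to89.B8SockLettersRD (SockLettersRD)
open Literature.MathematicalPhysics.QuantumFieldTheory.Balaban1983to89.B8Eq138LandauZd (covLap QT)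
open B7Prop1Explicit B7Prop2Explicit B7Prop1Local
open B8Ineq132 (InAk covDerivFwd)
open B7Eq78Linearization (zdBlocking QprimeIter)
open B8Eq119TwistedAxial (bgT)
open B8Eq140Level (SideTouches)
open B8Eq1117Concrete (XSpace)
open B8Prop5ContractionKLevel (Bd2)
open B8LambdaSpaceKLevel (wt)

open B9SupplySockB9P3ZdLetters (OpsZd)
open B9SupplySockB9P3ZdAt (DictAt Prop6At LandauAt SrcAt)
open B9SupplySockB9P3ZdAtLin (LinBddAt)
open B9SupplySockB9P3ZdGammaInAk (CurvAtInAk)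
open B9SupplySockB9P3ZdGammaUnivDelta2 (HolderAtδ2)
open B9SupplySockB9P3ZdAtHerm (InvAtH)
open B9SupplySockB9P3ZdGammaUnivDelta2Src (SrcHolderAtδ2)
open B9SupplySockB9P3ZdFrame (MemberZd memZd bgZd ιCfgZd reg335_bgZd_iff)
open B9Eq316AveragingTransposeZdPrinted (withQQP)
open B8Prop6Reg335ZdAllTorus (prop6At_bgZd_mono)
open B8Prop6Reg335ZdDomainSeq (prop6At_binder_domainSeq_holds)
open Summit.QuantumFields.YangMills.BalabanUVNodes.N05SubBP2DSlotExistsOfThm33JunctionHWithQQP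
  (exists_residB8_b8LeafOfRecordSubBP₂D_cutSubBP₅_of_letters_thm33_junctionH_withQQP)

-- `Site` alone could resolve to the torus sites of `Setup.lean`; re-export the `ℤ^d` sites of `B7Prop1Explicit`.
export B7Prop1Explicit (Site)

section WithQQPP6

/-- ★★★ **THE J-N06→N05 JUNCTION APPLIED ON THE «P₂D» ROAD AT THE `ℤᵈ` FRAME OF RECORD, PROPOSITION 6's BINDER DISCHARGED** — for `θ` with `2 ≤ θ.D`, `5 ≤ θ.L`:
Proposition 6 produces `c35₀, M₆ > 0` such that for every leaf constant `c35 ≥ c35₀` and every junction floor `M₃ ≥ M₆`, [4]'s letters `SLet ∕ SLetUB`, any half-frame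
`(geo, Gp, GA, ιLoc, ops)` over `MemberZd θ.D θ.L` with the backgrounds of record `bgZd θ.𝔸 θ.L`, N06's `B9.Thm33Printed c35 geo (bgZd θ.𝔸 θ.L) Gp GA`, the genuine
averaging letter pin `hops`, and the EIGHT junction binders `DictAt ∕ InvAtH ∕ CurvAtInAk ∕ LandauAt ∕ HolderAtδ2 ∕ LinBddAt ∕ SrcAt ∕ SrcHolderAtδ2` at every
`j : Node00.IdxB8SubD θ` give the N05 row `∃ lam c₁ ρ₀, B8LeafOfRecordSubBP₂D θ (lam.cutSubBP₅ c₁ ρ₀)`.  Proof: the companion theorem with `(I, mem, bg, ιCfg) :=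
(MemberZd, memZd, bgZd, ιCfgZd)` and `hP6 := prop6At_binder_domainSeq_holds` (every `IdxB8SubD` member obeys (1.3)–(1.4), `IdxB8SubD.domainSeq`; odd `L` is `θ.hL.1`),
moved to the leaf's `c35` by `prop6At_bgZd_mono`.  Hypotheses are N06 content; N05 NOT discharged.
[cite: Balaban1985RegularSpaces, Prop. 6 (1.134)–(1.138) p.99, (1.33) p.82, (1.3)–(1.5) p.77, Lemma 1 – Thm 8 pp.79–101; Balaban1985BackgroundPropagators, (3.35) p.396, Thm 3.1 p.397, Thm 3.3 p.399] -/
theorem exists_residB8_b8LeafOfRecordSubBP₂D_cutSubBP₅_of_letters_thm33_junctionH_withQQP_P6 (θ : Stage3Params) (hD : 2 ≤ θ.D) (hL5 : 5 ≤ θ.L)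
    [FiniteDimensional ℝ θ.𝔸] :
    ∃ c35₀ M₆ : ℝ, 0 < c35₀ ∧ 0 < M₆ ∧
      ∀ ⦃c35 : ℝ⦄, c35₀ ≤ c35 → ∀ ⦃M₃ : ℝ⦄, M₆ ≤ M₃ →
      -- [Balaban1985BackgroundPropagators] Thm 3.1's letter bounds and threshold
      ∀ {B₀'H B₂' BG BR cL : ℝ}, 0 < B₀'H → 0 ≤ B₂' → 0 ≤ BG → 0 ≤ BR → 0 < cL →
      -- [4]'s letters AT THE (1.3)–(1.5)-ADMISSIBLE `Ω₀ = ℤᵈ` LAW MEMBERS (p619291's texts verbatim): existence side and uniqueness side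
      (∀ i : ZdIdx θ.D θ.L, i.Ω 0 = Set.univ → IdxB8LawsB θ.L i → B8ConstraintBonds.DomainSeq θ.L i.Ω → (∀ l, l < i.k → ∀ z ∈ i.Λs i.k l, ((θ.L : ℤ) ^ l) • z ∈ B8ConstraintBonds.Lam θ.L i.Ω l) → SockLettersRD (𝔸 := θ.𝔸) θ.L BG BR B₀'H B₂' cL i.η i.k i.Ω i.Λs) →
      (∀ i : ZdIdx θ.D θ.L, i.Ω 0 = Set.univ → IdxB8LawsB θ.L i → B8ConstraintBonds.DomainSeq θ.L i.Ω → (∀ l, l < i.k → ∀ z ∈ i.Λs i.k l, ((θ.L : ℤ) ^ l) • z ∈ B8ConstraintBonds.Lam θ.L i.Ω l) → ∀ α₀ : ℝ, 0 < α₀ → α₀ ≤ cL → ∀ U₀ : Site θ.D → Fin θ.D → θ.𝔸ˣ, (∀ x κ, U₀ x κ ∈ unitaryUnits θ.𝔸) →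
        InAk θ.L i.k i.η α₀ i.Ω U₀ →
        ∃ (g Δ : (Site θ.D → θ.𝔸) →ₗ[ℂ] (Site θ.D → θ.𝔸)) (q : (Site θ.D → θ.𝔸) →ₗ[ℂ] (ℕ → Site θ.D → θ.𝔸))
          (qs : (ℕ → Site θ.D → θ.𝔸) →ₗ[ℂ] (Site θ.D → θ.𝔸)) (Aw c : (ℕ → Site θ.D → θ.𝔸) →ₗ[ℂ] (ℕ → Site θ.D → θ.𝔸))
          (H' : XSpace θ.D i.k θ.𝔸 →ₗ[ℂ] (Site θ.D → θ.𝔸)),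
          (∀ x : Site θ.D → θ.𝔸, (∃ C : ℝ, ∀ y, ‖x y‖ ≤ C) → g (Δ x + qs (Aw (q x))) = x) ∧ (∀ φ, qs (c (q (g (g (qs φ))))) = qs φ) ∧
          (∀ (f : Site θ.D → θ.𝔸), ∀ x ∈ i.Ω 0, Δ f x = covLap i.η U₀ ((i.Ω 0).indicator f) x) ∧
          (∀ (μ : ℕ → Site θ.D → θ.𝔸), ∀ x ∈ i.Ω 0, qs μ x = QT θ.L i.k (i.Λs i.k) U₀ μ x) ∧
          (∀ (f : Site θ.D → θ.𝔸) (n : ℕ), n ≤ i.k → ∀ y ∈ i.Λs i.k n, q f n y = QprimeIter (zdBlocking θ.D θ.L) (bgT θ.L U₀) n f y) ∧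
          (∀ (f : Site θ.D → θ.𝔸) (n : ℕ) (y : Site θ.D), ¬ (n ≤ i.k ∧ y ∈ i.Λs i.k n) → q f n y = 0) ∧
          (∀ (X : XSpace θ.D i.k θ.𝔸) (x : Site θ.D), ‖H' X x‖ ≤ B₀'H * ‖X‖) ∧
          (∀ n, n ≤ i.k → ∀ (X : XSpace θ.D i.k θ.𝔸), ∀ p ∈ {b : Site θ.D × Fin θ.D | SideTouches (i.Ω n) b.1 b.2},
            wt θ.L i.η n * ‖covDerivFwd i.η U₀ p.2 (H' X) p.1‖ ≤ B₀'H * ‖X‖) ∧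
          (∀ X : XSpace θ.D i.k θ.𝔸, Bd2 θ.L i.η i.k i.Ω (covLap i.η U₀ (H' X)) (B₂' * ‖X‖)) ∧
          (∀ (Y : XSpace θ.D i.k θ.𝔸) (n : ℕ) (hn : n ≤ i.k) (y : Site θ.D), y ∈ i.Λs i.k n →
            QprimeIter (zdBlocking θ.D θ.L) (bgT θ.L U₀) n (H' Y) y = Y (⟨n, Nat.lt_succ_of_le hn⟩, y)) ∧
          (∀ (f : Site θ.D → θ.𝔸) (r : ℝ), 0 ≤ r → Bd2 θ.L i.η i.k i.Ω f r →
            (∀ x, ‖g f x‖ ≤ BG * r) ∧ ∀ n, n ≤ i.k → ∀ p ∈ {b : Site θ.D × Fin θ.D | SideTouches (i.Ω n) b.1 b.2},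
              wt θ.L i.η n * ‖covDerivFwd i.η U₀ p.2 (g f) p.1‖ ≤ BG * r) ∧
          (∀ (f : Site θ.D → θ.𝔸) (r : ℝ), 0 ≤ r → Bd2 θ.L i.η i.k i.Ω f r → Bd2 θ.L i.η i.k i.Ω (f - g (qs (c (q (g f))))) (BR * r))) →
      -- N06's HALF-FRAME over the `ℤᵈ` members of record (geometries, the two kernel families of Thms 3.1–3.3 at the backgrounds `bgZd`, the locality map, the letters)
      ∀ (geo : MemberZd θ.D θ.L → B9.Geometry) (Gp GA : ∀ x, B9.KernelFamily (geo x) (bgZd θ.𝔸 θ.L x))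
        (ιLoc : ∀ (M : ℝ) (i : ZdIdx θ.D θ.L) (m : ℕ), (Site θ.D → Fin θ.D → θ.𝔸) → (geo (memZd M i m)).Loc)
        (ops : ℝ → ZdIdx θ.D θ.L → ℕ → OpsZd θ.D θ.𝔸)
      -- THE GENUINE AVERAGING LETTER (as in the companion; `θ.𝔸` finite-dimensional over `ℝ`, a theorem-level instance)
        (τ : θ.𝔸 →ₗ[ℂ] ℂ) {Cτ : ℝ}, (∀ x y : θ.𝔸, |(τ (star x * y)).re| ≤ Cτ * ‖x‖ * ‖y‖) →
      ∀ (ops₀ : ℝ → ZdIdx θ.D θ.L → ℕ → OpsZd θ.D θ.𝔸),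
        (∀ (M : ℝ) (i : ZdIdx θ.D θ.L) (m : ℕ), ops M i m = withQQP τ θ.L (fun m' l => towerBondsP θ.L i.Ω (i.Λs m') l) ops₀ M i m) →
      ∀ {a₃ c69 β cS cSβ : ℝ} {CH : ℝ → ℝ} {len : Site θ.D → ℝ},
      -- N06's THEOREM 3.3 AS PRINTED at the backgrounds of record, by name
        B9.Thm33Printed c35 geo (bgZd θ.𝔸 θ.L) Gp GA →
      -- dag-n06-b's JUNCTION DICTIONARY BINDERS at the (1.3)–(1.5)-admissible members, guarded — EIGHT of them: NO `havg` (companion), NO `hP6` (this file)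
        (∀ (M : ℝ) (j : IdxB8SubD θ) (m : ℕ), 1 ≤ M → M₃ ≤ M → m ≤ j.1.1.1.1.k → DictAt geo (bgZd θ.𝔸 θ.L) GA θ.L memZd (ιCfgZd θ.𝔸 θ.L) ιLoc ops M j.1.1.1.1 m) →
        (∀ (M : ℝ) (j : IdxB8SubD θ) (m : ℕ), 1 ≤ M → M₃ ≤ M → m ≤ j.1.1.1.1.k → InvAtH (bgZd θ.𝔸 θ.L) θ.L memZd (ιCfgZd θ.𝔸 θ.L) ops c35 a₃ M j.1.1.1.1 m) →
        (∀ (M : ℝ) (j : IdxB8SubD θ) (m : ℕ), 1 ≤ M → M₃ ≤ M → m ≤ j.1.1.1.1.k → CurvAtInAk θ.L ops c69 M j.1.1.1.1 m) →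
        (∀ (M : ℝ) (j : IdxB8SubD θ) (m : ℕ), 1 ≤ M → M₃ ≤ M → m ≤ j.1.1.1.1.k → LandauAt (bgZd θ.𝔸 θ.L) θ.L memZd (ιCfgZd θ.𝔸 θ.L) ops c35 a₃ M j.1.1.1.1 m) →
        (∀ (M : ℝ) (j : IdxB8SubD θ) (m : ℕ), 1 ≤ M → M₃ ≤ M → m ≤ j.1.1.1.1.k → HolderAtδ2 geo (bgZd θ.𝔸 θ.L) GA θ.L memZd (ιCfgZd θ.𝔸 θ.L) ops β len CH M j.1.1.1.1 m) →
        (∀ (M : ℝ) (j : IdxB8SubD θ) (m : ℕ), 1 ≤ M → M₃ ≤ M → m ≤ j.1.1.1.1.k → LinBddAt θ.L ops M j.1.1.1.1 m) →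
        (∀ (M : ℝ) (j : IdxB8SubD θ) (m : ℕ), 1 ≤ M → M₃ ≤ M → m ≤ j.1.1.1.1.k → SrcAt (bgZd θ.𝔸 θ.L) θ.L memZd (ιCfgZd θ.𝔸 θ.L) ops c35 a₃ cS M j.1.1.1.1 m) →
        (∀ (M : ℝ) (j : IdxB8SubD θ) (m : ℕ), 1 ≤ M → M₃ ≤ M → m ≤ j.1.1.1.1.k → SrcHolderAtδ2 (bgZd θ.𝔸 θ.L) θ.L memZd (ιCfgZd θ.𝔸 θ.L) ops c35 a₃ β len cSβ M j.1.1.1.1 m) →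
      -- the junction's primitive constants ((3.27) `a₃`, (3.69) `c69`, source `c_S c_Sβ`) and Theorem 8's source size factor `γ₈`
        0 < a₃ → 0 ≤ c69 → 0 ≤ cS → 0 ≤ cSβ → ∀ {γ₈ : ℝ}, 1 ≤ γ₈ →
        ∃ (lam : ResidB8 θ) (c₁ : ℝ) (ρ₀ : ℕ), B8LeafOfRecordSubBP₂D θ (lam.cutSubBP₅ c₁ ρ₀) := by
  have hL1 : 1 ≤ θ.L := le_trans (by norm_num) hL5
  -- [B8] PROPOSITION 6 at the `ℤᵈ` frame of record, every (1.3)–(1.4) member (dag-n05-e p620522 §4; odd `L` from the datum)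
  obtain ⟨c35₀, c₆, K₆, M₆, hc35₀, hc₆, hK₆, hM₆, hP6⟩ :=
    prop6At_binder_domainSeq_holds (𝔸 := θ.𝔸) hD hL5 θ.hL.1 (fun _ : ZdIdx θ.D θ.L => True)
  refine ⟨c35₀, M₆, hc35₀, hM₆, ?_⟩
  intro c35 hc35 M₃ hM₃ B₀'H B₂' BG BR cL hB₀'H hB₂' hBG hBR hcL SLet SLetUB geo Gp GA ιLoc ops τ Cτ hCτ ops₀ hops a₃ c69 β cS cSβ CH len
    h33 hdict hinv hcurv hlan hhol hlin hsrc hsrcH ha₃ hc69 hcS hcSβ γ₈ hγ₈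
  refine exists_residB8_b8LeafOfRecordSubBP₂D_cutSubBP₅_of_letters_thm33_junctionH_withQQP θ hD hL5 hB₀'H hB₂' hBG hBR hcL SLet SLetUB
    geo (bgZd θ.𝔸 θ.L) Gp GA memZd (ιCfgZd θ.𝔸 θ.L) ιLoc ops τ hCτ ops₀ hops h33 hdict ?_ hinv hcurv hlan hhol hlin hsrc hsrcH hc₆ hK₆ ha₃ hc69 hcS hcSβ hγ₈
  -- `hP6` DISCHARGED: the member obeys (1.3)–(1.4) (`IdxB8SubD.domainSeq`), the floor `M₆ ≤ M₃ ≤ M`, and the class constant moved up to the leaf's `c35`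
  intro M j m hM1 hM hm
  exact prop6At_bgZd_mono (𝔸 := θ.𝔸) hL1 hc35 (le_trans zero_le_one hM1) hK₆.le
    (hP6 M j.1.1.1.1 m trivial j.domainSeq (le_trans hM₃ hM))

end WithQQPP6

/-! ## §2 (v1.1) The index-generic edition: backgrounds of record through a re-indexing map -/

section WithQQPP6I

/-- ★★★ **THE INDEX-GENERIC EDITION (v1.1): THE BACKGROUNDS OF RECORD THROUGH A RE-INDEXING MAP `π : I → MemberZd θ.D θ.L`, PROPOSITION 6's BINDER DISCHARGED** —
for `θ` with `2 ≤ θ.D`, `5 ≤ θ.L`: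
Proposition 6 produces `c35₀, M₆ > 0` such that for every leaf constant `c35 ≥ c35₀` and every junction floor `M₃ ≥ M₆`, [4]'s letters `SLet ∕ SLetUB`, any index `I` with a
re-indexing map `π : I → MemberZd θ.D θ.L`, member map `mem` with `π (mem M j m) = memZd M j m` at the admissible members, half-frame `(geo, Gp, GA, ιLoc, ops)` over `I`
with the backgrounds of record `fun i => bgZd θ.𝔸 θ.L (π i)` and `ιCfg := ιCfgZd`, N06's `B9.Thm33Printed c35 geo (fun i => bgZd θ.𝔸 θ.L (π i)) Gp GA` (over `I` —
sound sub-indices are the consumer's choice), the genuine averaging letter pin `hops`, and the EIGHT junction binders `DictAt ∕ InvAtH ∕ CurvAtInAk ∕ LandauAt ∕ HolderAtδ2 ∕ LinBddAt ∕ SrcAt ∕ SrcHolderAtδ2` at every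
`j : Node00.IdxB8SubD θ` give the N05 row `∃ lam c₁ ρ₀, B8LeafOfRecordSubBP₂D θ (lam.cutSubBP₅ c₁ ρ₀)`.  Proof: the companion theorem with `bg := fun i => bgZd θ.𝔸 θ.L (π i)`,
`ιCfg := ιCfgZd` and `hP6 := prop6At_binder_domainSeq_holds` (every `IdxB8SubD` member obeys (1.3)–(1.4), `IdxB8SubD.domainSeq`; odd `L` is `θ.hL.1`), moved to the
leaf's `c35` by `prop6At_bgZd_mono` and transported along `hmem` through `reg335_bgZd_iff`.  Hypotheses are N06 content; N05 NOT discharged.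
[cite: Balaban1985RegularSpaces, Prop. 6 (1.134)–(1.138) p.99, (1.33) p.82, (1.3)–(1.5) p.77, Lemma 1 – Thm 8 pp.79–101; Balaban1985BackgroundPropagators, (3.35) p.396, Thm 3.1 p.397, Thm 3.3 p.399] -/
theorem exists_residB8_b8LeafOfRecordSubBP₂D_cutSubBP₅_of_letters_thm33_junctionH_withQQP_P6I (θ : Stage3Params) (hD : 2 ≤ θ.D) (hL5 : 5 ≤ θ.L)
    [FiniteDimensional ℝ θ.𝔸] :
    ∃ c35₀ M₆ : ℝ, 0 < c35₀ ∧ 0 < M₆ ∧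
      ∀ ⦃c35 : ℝ⦄, c35₀ ≤ c35 → ∀ ⦃M₃ : ℝ⦄, M₆ ≤ M₃ →
      -- [Balaban1985BackgroundPropagators] Thm 3.1's letter bounds and threshold
      ∀ {B₀'H B₂' BG BR cL : ℝ}, 0 < B₀'H → 0 ≤ B₂' → 0 ≤ BG → 0 ≤ BR → 0 < cL →
      -- [4]'s letters AT THE (1.3)–(1.5)-ADMISSIBLE `Ω₀ = ℤᵈ` LAW MEMBERS (p619291's texts verbatim): existence side and uniqueness side
      (∀ i : ZdIdx θ.D θ.L, i.Ω 0 = Set.univ → IdxB8LawsB θ.L i → B8ConstraintBonds.DomainSeq θ.L i.Ω → (∀ l, l < i.k → ∀ z ∈ i.Λs i.k l, ((θ.L : ℤ) ^ l) • z ∈ B8ConstraintBonds.Lam θ.L i.Ω l) → SockLettersRD (𝔸 := θ.𝔸) θ.L BG BR B₀'H B₂' cL i.η i.k i.Ω i.Λs) →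
      (∀ i : ZdIdx θ.D θ.L, i.Ω 0 = Set.univ → IdxB8LawsB θ.L i → B8ConstraintBonds.DomainSeq θ.L i.Ω → (∀ l, l < i.k → ∀ z ∈ i.Λs i.k l, ((θ.L : ℤ) ^ l) • z ∈ B8ConstraintBonds.Lam θ.L i.Ω l) → ∀ α₀ : ℝ, 0 < α₀ → α₀ ≤ cL → ∀ U₀ : Site θ.D → Fin θ.D → θ.𝔸ˣ, (∀ x κ, U₀ x κ ∈ unitaryUnits θ.𝔸) →
        InAk θ.L i.k i.η α₀ i.Ω U₀ →
        ∃ (g Δ : (Site θ.D → θ.𝔸) →ₗ[ℂ] (Site θ.D → θ.𝔸)) (q : (Site θ.D → θ.𝔸) →ₗ[ℂ] (ℕ → Site θ.D → θ.𝔸))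
          (qs : (ℕ → Site θ.D → θ.𝔸) →ₗ[ℂ] (Site θ.D → θ.𝔸)) (Aw c : (ℕ → Site θ.D → θ.𝔸) →ₗ[ℂ] (ℕ → Site θ.D → θ.𝔸))
          (H' : XSpace θ.D i.k θ.𝔸 →ₗ[ℂ] (Site θ.D → θ.𝔸)),
          (∀ x : Site θ.D → θ.𝔸, (∃ C : ℝ, ∀ y, ‖x y‖ ≤ C) → g (Δ x + qs (Aw (q x))) = x) ∧ (∀ φ, qs (c (q (g (g (qs φ))))) = qs φ) ∧
          (∀ (f : Site θ.D → θ.𝔸), ∀ x ∈ i.Ω 0, Δ f x = covLap i.η U₀ ((i.Ω 0).indicator f) x) ∧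
          (∀ (μ : ℕ → Site θ.D → θ.𝔸), ∀ x ∈ i.Ω 0, qs μ x = QT θ.L i.k (i.Λs i.k) U₀ μ x) ∧
          (∀ (f : Site θ.D → θ.𝔸) (n : ℕ), n ≤ i.k → ∀ y ∈ i.Λs i.k n, q f n y = QprimeIter (zdBlocking θ.D θ.L) (bgT θ.L U₀) n f y) ∧
          (∀ (f : Site θ.D → θ.𝔸) (n : ℕ) (y : Site θ.D), ¬ (n ≤ i.k ∧ y ∈ i.Λs i.k n) → q f n y = 0) ∧
          (∀ (X : XSpace θ.D i.k θ.𝔸) (x : Site θ.D), ‖H' X x‖ ≤ B₀'H * ‖X‖) ∧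
          (∀ n, n ≤ i.k → ∀ (X : XSpace θ.D i.k θ.𝔸), ∀ p ∈ {b : Site θ.D × Fin θ.D | SideTouches (i.Ω n) b.1 b.2},
            wt θ.L i.η n * ‖covDerivFwd i.η U₀ p.2 (H' X) p.1‖ ≤ B₀'H * ‖X‖) ∧
          (∀ X : XSpace θ.D i.k θ.𝔸, Bd2 θ.L i.η i.k i.Ω (covLap i.η U₀ (H' X)) (B₂' * ‖X‖)) ∧
          (∀ (Y : XSpace θ.D i.k θ.𝔸) (n : ℕ) (hn : n ≤ i.k) (y : Site θ.D), y ∈ i.Λs i.k n →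
            QprimeIter (zdBlocking θ.D θ.L) (bgT θ.L U₀) n (H' Y) y = Y (⟨n, Nat.lt_succ_of_le hn⟩, y)) ∧
          (∀ (f : Site θ.D → θ.𝔸) (r : ℝ), 0 ≤ r → Bd2 θ.L i.η i.k i.Ω f r →
            (∀ x, ‖g f x‖ ≤ BG * r) ∧ ∀ n, n ≤ i.k → ∀ p ∈ {b : Site θ.D × Fin θ.D | SideTouches (i.Ω n) b.1 b.2},
              wt θ.L i.η n * ‖covDerivFwd i.η U₀ p.2 (g f) p.1‖ ≤ BG * r) ∧
          (∀ (f : Site θ.D → θ.𝔸) (r : ℝ), 0 ≤ r → Bd2 θ.L i.η i.k i.Ω f r → Bd2 θ.L i.η i.k i.Ω (f - g (qs (c (q (g f))))) (BR * r))) →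
      -- ANY INDEX re-indexed into the `ℤᵈ` members of record by `π`, a member map landing on `memZd` at the admissible members, and N06's HALF-FRAME over it
      -- (geometries, the two kernel families of Thms 3.1–3.3 at the backgrounds `bgZd ∘ π`, the locality map, the letters)
      ∀ {I : Type} (π : I → MemberZd θ.D θ.L) (geo : I → B9.Geometry) (Gp GA : ∀ i, B9.KernelFamily (geo i) (bgZd θ.𝔸 θ.L (π i)))
        (mem : ℝ → ZdIdx θ.D θ.L → ℕ → I),
        (∀ (M : ℝ) (j : IdxB8SubD θ) (m : ℕ), π (mem M j.1.1.1.1 m) = memZd M j.1.1.1.1 m) →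
      ∀ (ιLoc : ∀ (M : ℝ) (i : ZdIdx θ.D θ.L) (m : ℕ), (Site θ.D → Fin θ.D → θ.𝔸) → (geo (mem M i m)).Loc)
        (ops : ℝ → ZdIdx θ.D θ.L → ℕ → OpsZd θ.D θ.𝔸)
      -- THE GENUINE AVERAGING LETTER (as in the companion; `θ.𝔸` finite-dimensional over `ℝ`, a theorem-level instance)
        (τ : θ.𝔸 →ₗ[ℂ] ℂ) {Cτ : ℝ}, (∀ x y : θ.𝔸, |(τ (star x * y)).re| ≤ Cτ * ‖x‖ * ‖y‖) →
      ∀ (ops₀ : ℝ → ZdIdx θ.D θ.L → ℕ → OpsZd θ.D θ.𝔸),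
        (∀ (M : ℝ) (i : ZdIdx θ.D θ.L) (m : ℕ), ops M i m = withQQP τ θ.L (fun m' l => towerBondsP θ.L i.Ω (i.Λs m') l) ops₀ M i m) →
      ∀ {a₃ c69 β cS cSβ : ℝ} {CH : ℝ → ℝ} {len : Site θ.D → ℝ},
      -- N06's THEOREM 3.3 AS PRINTED at the backgrounds of record, by name
        B9.Thm33Printed c35 geo (fun i => bgZd θ.𝔸 θ.L (π i)) Gp GA →
      -- dag-n06-b's JUNCTION DICTIONARY BINDERS at the (1.3)–(1.5)-admissible members, guarded — EIGHT of them: NO `havg` (companion), NO `hP6` (this file)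
        (∀ (M : ℝ) (j : IdxB8SubD θ) (m : ℕ), 1 ≤ M → M₃ ≤ M → m ≤ j.1.1.1.1.k → DictAt geo (fun i => bgZd θ.𝔸 θ.L (π i)) GA θ.L mem (fun M i m U₀ hU₀ => ιCfgZd θ.𝔸 θ.L M i m U₀ hU₀) ιLoc ops M j.1.1.1.1 m) →
        (∀ (M : ℝ) (j : IdxB8SubD θ) (m : ℕ), 1 ≤ M → M₃ ≤ M → m ≤ j.1.1.1.1.k → InvAtH (fun i => bgZd θ.𝔸 θ.L (π i)) θ.L mem (fun M i m U₀ hU₀ => ιCfgZd θ.𝔸 θ.L M i m U₀ hU₀) ops c35 a₃ M j.1.1.1.1 m) →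
        (∀ (M : ℝ) (j : IdxB8SubD θ) (m : ℕ), 1 ≤ M → M₃ ≤ M → m ≤ j.1.1.1.1.k → CurvAtInAk θ.L ops c69 M j.1.1.1.1 m) →
        (∀ (M : ℝ) (j : IdxB8SubD θ) (m : ℕ), 1 ≤ M → M₃ ≤ M → m ≤ j.1.1.1.1.k → LandauAt (fun i => bgZd θ.𝔸 θ.L (π i)) θ.L mem (fun M i m U₀ hU₀ => ιCfgZd θ.𝔸 θ.L M i m U₀ hU₀) ops c35 a₃ M j.1.1.1.1 m) →
        (∀ (M : ℝ) (j : IdxB8SubD θ) (m : ℕ), 1 ≤ M → M₃ ≤ M → m ≤ j.1.1.1.1.k → HolderAtδ2 geo (fun i => bgZd θ.𝔸 θ.L (π i)) GA θ.L mem (fun M i m U₀ hU₀ => ιCfgZd θ.𝔸 θ.L M i m U₀ hU₀) ops β len CH M j.1.1.1.1 m) →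
        (∀ (M : ℝ) (j : IdxB8SubD θ) (m : ℕ), 1 ≤ M → M₃ ≤ M → m ≤ j.1.1.1.1.k → LinBddAt θ.L ops M j.1.1.1.1 m) →
        (∀ (M : ℝ) (j : IdxB8SubD θ) (m : ℕ), 1 ≤ M → M₃ ≤ M → m ≤ j.1.1.1.1.k → SrcAt (fun i => bgZd θ.𝔸 θ.L (π i)) θ.L mem (fun M i m U₀ hU₀ => ιCfgZd θ.𝔸 θ.L M i m U₀ hU₀) ops c35 a₃ cS M j.1.1.1.1 m) →
        (∀ (M : ℝ) (j : IdxB8SubD θ) (m : ℕ), 1 ≤ M → M₃ ≤ M → m ≤ j.1.1.1.1.k → SrcHolderAtδ2 (fun i => bgZd θ.𝔸 θ.L (π i)) θ.L mem (fun M i m U₀ hU₀ => ιCfgZd θ.𝔸 θ.L M i m U₀ hU₀) ops c35 a₃ β len cSβ M j.1.1.1.1 m) →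
      -- the junction's primitive constants ((3.27) `a₃`, (3.69) `c69`, source `c_S c_Sβ`) and Theorem 8's source size factor `γ₈`
        0 < a₃ → 0 ≤ c69 → 0 ≤ cS → 0 ≤ cSβ → ∀ {γ₈ : ℝ}, 1 ≤ γ₈ →
        ∃ (lam : ResidB8 θ) (c₁ : ℝ) (ρ₀ : ℕ), B8LeafOfRecordSubBP₂D θ (lam.cutSubBP₅ c₁ ρ₀) := by
  have hL1 : 1 ≤ θ.L := le_trans (by norm_num) hL5
  -- [B8] PROPOSITION 6 at the `ℤᵈ` frame of record, every (1.3)–(1.4) member (dag-n05-e p620522 §4; odd `L` from the datum)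
  obtain ⟨c35₀, c₆, K₆, M₆, hc35₀, hc₆, hK₆, hM₆, hP6⟩ :=
    prop6At_binder_domainSeq_holds (𝔸 := θ.𝔸) hD hL5 θ.hL.1 (fun _ : ZdIdx θ.D θ.L => True)
  refine ⟨c35₀, M₆, hc35₀, hM₆, ?_⟩
  intro c35 hc35 M₃ hM₃ B₀'H B₂' BG BR cL hB₀'H hB₂' hBG hBR hcL SLet SLetUB I π geo Gp GA mem hmem ιLoc ops τ Cτ hCτ ops₀ hops a₃ c69 β cS cSβ CH len
    h33 hdict hinv hcurv hlan hhol hlin hsrc hsrcH ha₃ hc69 hcS hcSβ γ₈ hγ₈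
  refine exists_residB8_b8LeafOfRecordSubBP₂D_cutSubBP₅_of_letters_thm33_junctionH_withQQP θ hD hL5 hB₀'H hB₂' hBG hBR hcL SLet SLetUB
    geo (fun i => bgZd θ.𝔸 θ.L (π i)) Gp GA mem (fun M i m U₀ hU₀ => ιCfgZd θ.𝔸 θ.L M i m U₀ hU₀) ιLoc ops τ hCτ ops₀ hops h33 hdict ?_ hinv hcurv hlan hhol hlin hsrc hsrcH hc₆ hK₆ ha₃ hc69 hcS hcSβ hγ₈
  -- `hP6` DISCHARGED: the member obeys (1.3)–(1.4) (`IdxB8SubD.domainSeq`), the floor `M₆ ≤ M₃ ≤ M`, the class constant moved up to the leaf's `c35`,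
  -- and the (3.35) field transported from `memZd M j m` to `π (mem M j m)` along `hmem` (the field unfolded by `reg335_bgZd_iff`)
  intro M j m hM1 hM hm α₀ U₀ hU₀ hα₀ hMα hIn
  have h6 := prop6At_bgZd_mono (𝔸 := θ.𝔸) hL1 hc35 (le_trans zero_le_one hM1) hK₆.le
    (hP6 M j.1.1.1.1 m trivial j.domainSeq (le_trans hM₃ hM)) α₀ U₀ hU₀ hα₀ hMα hIn
  rw [reg335_bgZd_iff] at h6
  show (bgZd θ.𝔸 θ.L (π (mem M j.1.1.1.1 m))).Reg335 c35 (K₆ * α₀) (ιCfgZd θ.𝔸 θ.L M j.1.1.1.1 m U₀ hU₀)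
  rw [reg335_bgZd_iff, hmem M j m]
  exact h6

end WithQQPP6I


end Summit.QuantumFields.YangMills.BalabanUVNodes.N05SubBP2DSlotExistsOfThm33JunctionHWithQQPP6

end
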